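import Literature.Analysis.Fourier.HilbertTransformCircle
import Mathlib.MeasureTheory.Integral.DominatedConvergence
import Mathlib.Topology.Algebra.InfiniteSum.Real
import Mathlib.Analysis.Normed.Group.InfiniteSum
import HarnessLib

/-!
# The periodic Hilbert transform of a trigonometric SERIES, termwise

Topic `Literature/Analysis/Fourier`. For the operator `hilbertTransformCircle` of `HilbertTransformCircle.lean` (p.v. cot kernel,
`H sin = −cos`) and real coefficient sequences with `Σ_k (k+1)(|α_k| + |β_k|) < ∞` (in particular every real-analytic periodic
function, whose coefficients decay geometrically), the multiplier `−i·sgn k` acts termwise on the series: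

  `H[Σ_{k≥0} (α_k sin((k+1)·) + β_k cos((k+1)·))](x) = Σ_{k≥0} (−α_k cos((k+1)x) + β_k sin((k+1)x))`

[cite: Grafakos2014, Ex. 4.1.4(c) (the conjugate function / conjugate Poisson boundary operator acts as `−i sgn k` on Fourier
coefficients)]. Proof: dominated convergence for sums on `[0, π]` (Mathlib `intervalIntegral.hasSum_integral_of_dominated_convergence`)
with the elementary domination `|sin((k+1)t)·cot(t/2)| ≤ 2(k+1)` on `(0, π]` (from `|sin(n s)| ≤ n|sin s|`), and the one-mode identity
`hilbertTransformCircle_mode`. This is the form in which the analytic Fourier-side profiles of the 1-D circle models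
(`OkamotoSakajoWunsch2008/SeparableBlowup.lean`: `fourierEval`, `hilbertCoeff`; the OSW certified ladder) meet the analytic operator.
No new definition.
-/

namespace Literature.Analysis.Fourier

open _root_.MeasureTheory Set Filter intervalIntegral
open scoped Real Topology Interval

/-- `|sin(n s)| ≤ n·|sin s|` for every natural `n` (induction on the addition formula). [folklore] -/
private theorem abs_sin_nat_mul_le (n : ℕ) (s : ℝ) : |Real.sin (n * s)| ≤ n * |Real.sin s| := by
  induction n with
  | zero => simp
  | succ n ih =>
    have h : Real.sin (((n + 1 : ℕ) : ℝ) * s) = Real.sin (n * s) * Real.cos s + Real.cos (n * s) * Real.sin s := by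
      push_cast
      rw [add_mul, one_mul, Real.sin_add]
    rw [h]
    have h1 : |Real.sin (n * s) * Real.cos s| ≤ n * |Real.sin s| := by
      rw [abs_mul]
      calc |Real.sin (n * s)| * |Real.cos s| ≤ n * |Real.sin s| * 1 :=
            mul_le_mul ih (Real.abs_cos_le_one s) (abs_nonneg _) (by positivity)
        _ = n * |Real.sin s| := mul_one _
    have h2 : |Real.cos (n * s) * Real.sin s| ≤ |Real.sin s| := by
      rw [abs_mul]
      calc |Real.cos (n * s)| * |Real.sin s| ≤ 1 * |Real.sin s| :=
            mul_le_mul_of_nonneg_right (Real.abs_cos_le_one _) (abs_nonneg _)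
        _ = |Real.sin s| := one_mul _
    calc |Real.sin (n * s) * Real.cos s + Real.cos (n * s) * Real.sin s|
        ≤ |Real.sin (n * s) * Real.cos s| + |Real.cos (n * s) * Real.sin s| := abs_add_le _ _
      _ ≤ n * |Real.sin s| + |Real.sin s| := add_le_add h1 h2
      _ = ((n + 1 : ℕ) : ℝ) * |Real.sin s| := by push_cast; ring

/-- Domination of the mode kernel: `|sin(m t)·cot(t/2)| ≤ 2m` on `(0, π]` (`m ∈ ℕ`). [folklore] -/
private theorem abs_sin_mul_cot_half_le (m : ℕ) {t : ℝ} (ht : t ∈ Ioc (0 : ℝ) π) :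
    |Real.sin (m * t) * (Real.cos (t / 2) / Real.sin (t / 2))| ≤ 2 * m := by
  have hs : 0 < Real.sin (t / 2) :=
    Real.sin_pos_of_pos_of_lt_pi (by linarith [ht.1]) (by linarith [ht.2, Real.pi_pos])
  have hmt : (m : ℝ) * t = ((2 * m : ℕ) : ℝ) * (t / 2) := by push_cast; ring
  rw [hmt, abs_mul, abs_div, abs_of_pos hs]
  have h1 := abs_sin_nat_mul_le (2 * m) (t / 2)
  rw [abs_of_pos hs] at h1
  calc |Real.sin (((2 * m : ℕ) : ℝ) * (t / 2))| * (|Real.cos (t / 2)| / Real.sin (t / 2))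
      ≤ ((2 * m : ℕ) : ℝ) * Real.sin (t / 2) * (1 / Real.sin (t / 2)) := by
        gcongr
        exact Real.abs_cos_le_one _
    _ = 2 * m := by push_cast; field_simp

/-- The symmetric integrand of one mode, factored: `(g(x−t) − g(x+t))·cot(t/2) = 2(−α cos(mx) + β sin(mx))·(sin(mt) cot(t/2))` for
`g = α sin(m·) + β cos(m·)`. [folklore] -/
private theorem mode_symm_integrand (α β m x t : ℝ) :
    ((α * Real.sin (m * (x - t)) + β * Real.cos (m * (x - t))) - (α * Real.sin (m * (x + t)) + β * Real.cos (m * (x + t))))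
        * (Real.cos (t / 2) / Real.sin (t / 2)) =
      2 * (-α * Real.cos (m * x) + β * Real.sin (m * x)) * (Real.sin (m * t) * (Real.cos (t / 2) / Real.sin (t / 2))) := by
  have hs : Real.sin (m * (x - t)) - Real.sin (m * (x + t)) = -2 * Real.cos (m * x) * Real.sin (m * t) := by
    rw [Real.sin_sub_sin]
    have e1 : (m * (x - t) - m * (x + t)) / 2 = -(m * t) := by ring
    have e2 : (m * (x - t) + m * (x + t)) / 2 = m * x := by ring
    rw [e1, e2, Real.sin_neg]; ring
  have hc : Real.cos (m * (x - t)) - Real.cos (m * (x + t)) = 2 * Real.sin (m * x) * Real.sin (m * t) := by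
    rw [Real.cos_sub_cos]
    have e1 : (m * (x - t) + m * (x + t)) / 2 = m * x := by ring
    have e2 : (m * (x - t) - m * (x + t)) / 2 = -(m * t) := by ring
    rw [e1, e2, Real.sin_neg]; ring
  have : (α * Real.sin (m * (x - t)) + β * Real.cos (m * (x - t))) - (α * Real.sin (m * (x + t)) + β * Real.cos (m * (x + t)))
      = α * (Real.sin (m * (x - t)) - Real.sin (m * (x + t))) + β * (Real.cos (m * (x - t)) - Real.cos (m * (x + t))) := by ring
  rw [this, hs, hc]
  ring

/-- **The periodic Hilbert transform of a trigonometric series, termwise.** If `Σ_k (k+1)(|α_k| + |β_k|) < ∞` then at every `x`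
`H[Σ_k (α_k sin((k+1)·) + β_k cos((k+1)·))](x) = Σ_k (−α_k cos((k+1)x) + β_k sin((k+1)x))` — the multiplier `−i sgn k` on the whole
series. [cite: Grafakos2014, Ex. 4.1.4(c) (conjugate function acts as `−i sgn k` on Fourier coefficients)] -/
theorem hilbertTransformCircle_tsum {α β : ℕ → ℝ} (hs : Summable fun k : ℕ => ((k : ℝ) + 1) * (|α k| + |β k|)) (x : ℝ) :
    hilbertTransformCircle (fun y => ∑' k, (α k * Real.sin (((k + 1 : ℕ) : ℝ) * y) + β k * Real.cos (((k + 1 : ℕ) : ℝ) * y))) x =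
      ∑' k, (-α k * Real.cos (((k + 1 : ℕ) : ℝ) * x) + β k * Real.sin (((k + 1 : ℕ) : ℝ) * x)) := by
  -- termwise summability of the series itself (|term| ≤ |α_k| + |β_k| ≤ (k+1)(|α_k|+|β_k|))
  have hab : Summable fun k : ℕ => |α k| + |β k| := by
    refine Summable.of_nonneg_of_le (fun k => by positivity) (fun k => ?_) hs
    have hk : (1 : ℝ) ≤ (k : ℝ) + 1 := by have := Nat.cast_nonneg (α := ℝ) k; linarith
    calc |α k| + |β k| = 1 * (|α k| + |β k|) := (one_mul _).symm
      _ ≤ ((k : ℝ) + 1) * (|α k| + |β k|) := by gcongr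
  have hterm : ∀ y : ℝ, Summable fun k => α k * Real.sin (((k + 1 : ℕ) : ℝ) * y) + β k * Real.cos (((k + 1 : ℕ) : ℝ) * y) := by
    intro y
    refine Summable.of_norm_bounded hab (fun k => ?_)
    rw [Real.norm_eq_abs]
    calc |α k * Real.sin (((k + 1 : ℕ) : ℝ) * y) + β k * Real.cos (((k + 1 : ℕ) : ℝ) * y)|
        ≤ |α k * Real.sin (((k + 1 : ℕ) : ℝ) * y)| + |β k * Real.cos (((k + 1 : ℕ) : ℝ) * y)| := abs_add_le _ _
      _ ≤ |α k| * 1 + |β k| * 1 := by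
          rw [abs_mul, abs_mul]
          gcongr
          · exact Real.abs_sin_le_one _
          · exact Real.abs_cos_le_one _
      _ = |α k| + |β k| := by ring
  -- the mode integrands, their domination and their integrals
  set F : ℕ → ℝ → ℝ := fun k t =>
    ((α k * Real.sin (((k + 1 : ℕ) : ℝ) * (x - t)) + β k * Real.cos (((k + 1 : ℕ) : ℝ) * (x - t)))
      - (α k * Real.sin (((k + 1 : ℕ) : ℝ) * (x + t)) + β k * Real.cos (((k + 1 : ℕ) : ℝ) * (x + t))))
      * (Real.cos (t / 2) / Real.sin (t / 2)) with hFdef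
  set bound : ℕ → ℝ → ℝ := fun k _ => 4 * (((k : ℝ) + 1) * (|α k| + |β k|)) with hbdef
  have hF_meas : ∀ k, AEStronglyMeasurable (F k) (volume.restrict (Ι (0 : ℝ) π)) := by
    intro k
    have : Measurable (F k) := by
      simp only [hFdef]
      fun_prop
    exact this.aestronglyMeasurable
  have h_bound : ∀ k, ∀ᵐ t ∂volume, t ∈ Ι (0 : ℝ) π → ‖F k t‖ ≤ bound k t := by
    intro k
    refine Eventually.of_forall fun t ht => ?_
    rw [uIoc_of_le Real.pi_pos.le] at ht
    simp only [hFdef, hbdef]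
    rw [Real.norm_eq_abs, mode_symm_integrand, abs_mul, abs_mul]
    have hk := abs_sin_mul_cot_half_le (k + 1) ht
    push_cast at hk
    have h2 : |-α k * Real.cos (((k + 1 : ℕ) : ℝ) * x) + β k * Real.sin (((k + 1 : ℕ) : ℝ) * x)| ≤ |α k| + |β k| := by
      calc |-α k * Real.cos (((k + 1 : ℕ) : ℝ) * x) + β k * Real.sin (((k + 1 : ℕ) : ℝ) * x)|
          ≤ |-α k * Real.cos (((k + 1 : ℕ) : ℝ) * x)| + |β k * Real.sin (((k + 1 : ℕ) : ℝ) * x)| := abs_add_le _ _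
        _ ≤ |α k| * 1 + |β k| * 1 := by
            rw [abs_mul, abs_mul, abs_neg]
            gcongr
            · exact Real.abs_cos_le_one _
            · exact Real.abs_sin_le_one _
        _ = |α k| + |β k| := by ring
    rw [show |(2 : ℝ)| = 2 by norm_num]
    push_cast
    calc 2 * |-α k * Real.cos (((k : ℝ) + 1) * x) + β k * Real.sin (((k : ℝ) + 1) * x)|
          * |Real.sin (((k : ℝ) + 1) * t) * (Real.cos (t / 2) / Real.sin (t / 2))|
        ≤ 2 * (|α k| + |β k|) * (2 * ((k : ℝ) + 1)) := by
          gcongr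
          · push_cast at h2; exact h2
      _ = 4 * (((k : ℝ) + 1) * (|α k| + |β k|)) := by ring
  have bound_summable : ∀ᵐ t ∂volume, t ∈ Ι (0 : ℝ) π → Summable fun k => bound k t :=
    Eventually.of_forall fun t _ => hs.mul_left 4
  have bound_integrable : IntervalIntegrable (fun t => ∑' k, bound k t) volume 0 π := by
    simp only [hbdef]
    exact intervalIntegrable_const
  have h_lim : ∀ᵐ t ∂volume, t ∈ Ι (0 : ℝ) π →
      HasSum (fun k => F k t)
        (((∑' k, (α k * Real.sin (((k + 1 : ℕ) : ℝ) * (x - t)) + β k * Real.cos (((k + 1 : ℕ) : ℝ) * (x - t))))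
          - ∑' k, (α k * Real.sin (((k + 1 : ℕ) : ℝ) * (x + t)) + β k * Real.cos (((k + 1 : ℕ) : ℝ) * (x + t))))
          * (Real.cos (t / 2) / Real.sin (t / 2))) := by
    refine Eventually.of_forall fun t _ => ?_
    have h := (((hterm (x - t)).hasSum).sub ((hterm (x + t)).hasSum)).mul_right (Real.cos (t / 2) / Real.sin (t / 2))
    refine h.congr_fun fun k => ?_
    simp only [hFdef]
  have hDC := intervalIntegral.hasSum_integral_of_dominated_convergence bound hF_meas h_bound bound_summable
    bound_integrable h_lim
  -- each mode integral is 2π·(−α_k cos + β_k sin)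
  have hmode : ∀ k, ∫ t in (0 : ℝ)..π, F k t =
      2 * π * (-α k * Real.cos (((k + 1 : ℕ) : ℝ) * x) + β k * Real.sin (((k + 1 : ℕ) : ℝ) * x)) := by
    intro k
    have h := hilbertTransformCircle_mode (k + 1) (by omega) (α k) (β k) x
    unfold hilbertTransformCircle at h
    have hπ : (2 * π : ℝ) ≠ 0 := by positivity
    have h' := congrArg (fun z => 2 * π * z) h
    simp only at h'
    rw [← mul_assoc, mul_inv_cancel₀ hπ, one_mul] at h'
    simpa only [hFdef] using h'
  have hsum2 : HasSum (fun k => 2 * π * (-α k * Real.cos (((k + 1 : ℕ) : ℝ) * x) + β k * Real.sin (((k + 1 : ℕ) : ℝ) * x)))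
      (∫ t in (0 : ℝ)..π, ((∑' k, (α k * Real.sin (((k + 1 : ℕ) : ℝ) * (x - t)) + β k * Real.cos (((k + 1 : ℕ) : ℝ) * (x - t))))
          - ∑' k, (α k * Real.sin (((k + 1 : ℕ) : ℝ) * (x + t)) + β k * Real.cos (((k + 1 : ℕ) : ℝ) * (x + t))))
          * (Real.cos (t / 2) / Real.sin (t / 2))) := by
    refine hDC.congr_fun fun k => ?_
    exact (hmode k).symm
  unfold hilbertTransformCircle
  rw [← hsum2.tsum_eq, tsum_mul_left]
  have hπ : (2 * π : ℝ) ≠ 0 := by positivity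
  rw [← mul_assoc, inv_mul_cancel₀ hπ, one_mul]

end Literature.Analysis.Fourier
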